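import Summits.ResolutionOfSingularities.ResolutionOfSingularities.Theorems.FrobeniusClosingSteerArithReduction
import Summits.ResolutionOfSingularities.ResolutionOfSingularities.Theorems.FrobeniusClosingSteerOddBranchResidueZero
import Summits.ResolutionOfSingularities.ResolutionOfSingularities.Theorems.FrobeniusClosingSteerSigmaTopMaximality
import Summits.ResolutionOfSingularities.ResolutionOfSingularities.Theorems.FrobeniusClosingSteerSwitchPlaneTwo
import Summits.ResolutionOfSingularities.ResolutionOfSingularities.Theorems.FrobeniusClosingSteerWords12MemberDatum
import Mathlib.Algebra.CharP.Two

/-!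
# Crux `Steer` (stmt-ResolutionOfSingularities-16345), chain W4.1, (Par-S) hARᵒ STAGE 2: the LEGALITY slot (H3) at the run level
# «a residue zero of the binary residue form at a late A-stage forces a positive step of height ≥ 2 at the next visit»
# (res-type-062 g15; blueprint `L/res-type-062/hAR-BLUEPRINT.md` S5; res-L0-w41-plan-1 RULINGS 121c/137a; over res-D-pv-003's brick #2
# `OddBranchParity.exists_isPermissibleCentre_of_residue_zero` p535179, res-L0-w41-tri-1's WORDS 12 `VisitLawAt` p535085 and
# `SigmaTopMaximality` p535258; Theses-free support)

OURS (campaign `res-hironaka`, rung L ★L-G4, slot W4.1; statements about the route's own objects — a σ_top-steered run `Words.IsSteeredRun O R P t 2 s`,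
its visit pairs (`Words.IsVisitPair`: consecutive point steps), the one-step law between visits (`Words.VisitLawAt`, res-type-096's S1a target), the
binary residue datum of the word `ArithBinaryResidueAt`; they replace the role of no printed item and are NOT statements of the manuscript under review
[claim: Hironaka2017, status: under-review]; AI review is weaker than expert review). Seat res-type-062 g15. Definition-free; no Theses file is imported.

## What is proved

* §1 `exists_isVisitPair` — if point steps recur, every point step `i` has a NEXT point step `j′` (`IsVisitPair R P i j′`).
* §2 `sq_eq_of_law`, `sq_eq_of_law_odd`, `sq_eq_of_law_odd_unit` — the composite strict-transform law `s′·u^m·W = s − G′` (unit cofactor `W`,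
  res-type-096's repair of `VisitLawAt` clause 2) in characteristic `2`: with `d = 2m+1`, `s′² = u·(W⁻²(s² − g²)/u^d) + (W⁻¹(g − G′)/u^m)²`.
* §3 **`exists_posStepTwo_of_residue_zero`** (H3 core): at a point step `i` with regular member, an ON-AXIS binary datum of ODD degree `d` which is
  the EXACT cleaned order (`HasCleanedOrderAt R s 2 i d`), a residue zero of `Ψ̄`, the next visit `j′` with the visit law, `R j′` regular of dimension
  `n ≥ 3` and no singular primes of height `0`/`1` at `j′`: a permissible centre exists at `j′` (pv-003), hence (σ_top maximality, `SigmaTopMaximality`)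
  `IsPosStep R P j′ ∧ 2 ≤ (P j′).height`.
* §4 **`H3_of_pieces`** — the slot (H3) of `ArithReduction.arithSwitchClause_of_…` in its FINAL shape (A-stage input), from: point steps recur, the visit
  law at every late visit (S1a), members regular, members of dimension `n ≥ 3`, and no singular primes of height `≤ 1` at late point steps (N4).
* §5 **`arithSwitchClause_of_AStage_bricks(_run)`** — STAGE 1 glue, v3: as `arithSwitchClause_of_memberDatum` but (H2) outputs an A-STAGE
  (`Words.IsAStageAt R P s p i d`: the degree `d` IS the cleaned order — a B-stage with `Ψ = 0` would make (H3) unprovable) and (H3) consumes it.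

[cite: NovacoskiSpivakovsky2014, Def. 2.11] [cite: CossartJannsenSaito2009, Thm. 5.25] [folklore]
-/

-- `Summit.<S>.<S>.…` duplicates the summit name by design (single-problem summit).
set_option linter.dupNamespace false

open IsLocalRing MvPolynomial
open Literature.AlgebraicGeometry.Resolution (IsLocalBlowupAlong SubringDominates IsRsopPart locAtCentre
  subringDominates_locAtCentre)

namespace Summit.ResolutionOfSingularities.ResolutionOfSingularities.Theorems.SwitchingDichotomy

namespace ArithReductionLegality

open Summit.ResolutionOfSingularities.ResolutionOfSingularities.Theorems.SwitchingDichotomy.SigmaTopLegality (IsPointStep IsPosStep)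
open Summit.ResolutionOfSingularities.ResolutionOfSingularities.Theorems.SwitchingDichotomy.Words
  (IsSteeredRun HasCleanedOrderAt HasReducedOrderAt IsAStageAt IsVisitPair VisitLawAt EventuallyConstantReducedOrder)
open Summit.ResolutionOfSingularities.ResolutionOfSingularities.Theorems.SwitchingDichotomy.ArithReduction
  (ArithBinaryResidueAt ArithSwitchClause OddCleanedPointStepAt)

variable {K : Type} [Field K]

/-! ## §1 The next visit -/

/-- If point steps recur, every point step has a NEXT point step (a visit pair). [folklore] -/
theorem exists_isVisitPair {R : ℕ → Subring K} {P : (i : ℕ) → Ideal (R i)}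
    (hrec : ∀ i₀, ∃ i, i₀ ≤ i ∧ IsPointStep R P i) {i : ℕ} (hpt : IsPointStep R P i) :
    ∃ j', IsVisitPair R P i j' := by
  classical
  have hex : ∃ j, i < j ∧ IsPointStep R P j := by
    obtain ⟨j, hj, hptj⟩ := hrec (i + 1)
    exact ⟨j, hj, hptj⟩
  refine ⟨Nat.find hex, (Nat.find_spec hex).1, hpt, (Nat.find_spec hex).2, fun k hik hkj hptk => ?_⟩
  exact Nat.find_min hex hkj ⟨hik, hptk⟩

/-! ## §2 The composite law in characteristic 2 -/

/-- `s′·u^m = s − G′` in characteristic `2` ⇒ `s′² · (u^m)² = (s² − g²) + (g − G′)²` for every `g`. [folklore] -/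
theorem sq_eq_of_law [CharP K 2] {s' s u G' g : K} {m : ℕ} (hlaw : s' * u ^ m = s - G') :
    s' ^ 2 * (u ^ m) ^ 2 = (s ^ 2 - g ^ 2) + (g - G') ^ 2 := by
  have h1 : (s' * u ^ m) ^ 2 = (s - G') ^ 2 := by rw [hlaw]
  rw [mul_pow] at h1
  have h2 : (2 : K) = 0 := CharTwo.two_eq_zero
  rw [h1]
  linear_combination (g * G' - s * G') * h2

/-- With `d = 2m + 1` and `u ≠ 0`: `s′² = u·((s² − g²)/u^d) + ((g − G′)/u^m)²`. [folklore] -/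
theorem sq_eq_of_law_odd [CharP K 2] {s' s u G' g : K} {m : ℕ} (hu : u ≠ 0) (hlaw : s' * u ^ m = s - G') :
    s' ^ 2 = u * ((s ^ 2 - g ^ 2) / u ^ (2 * m + 1)) + ((g - G') / u ^ m) ^ 2 := by
  have h := sq_eq_of_law (g := g) hlaw
  have hum : u ^ m ≠ 0 := pow_ne_zero _ hu
  have hum2 : (u ^ m) ^ 2 ≠ 0 := pow_ne_zero _ hum
  have hu21 : u ^ (2 * m + 1) = u * (u ^ m) ^ 2 := by ring
  rw [hu21]
  have e1 : u * ((s ^ 2 - g ^ 2) / (u * (u ^ m) ^ 2)) = (s ^ 2 - g ^ 2) / (u ^ m) ^ 2 := by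
    field_simp
  have e2 : ((g - G') / u ^ m) ^ 2 = (g - G') ^ 2 / (u ^ m) ^ 2 := by rw [div_pow]
  rw [e1, e2, ← add_div, ← h, mul_div_assoc, div_self hum2, mul_one]

/-- The law WITH A UNIT COFACTOR (res-type-096's repair R1 of `VisitLawAt` clause 2: the strict transform is determined only up to a unit):
`s′·u^m·W = s − G′`, `W ≠ 0`, `u ≠ 0` ⇒ `s′² = u·(W⁻¹²·(s² − g²)/u^(2m+1)) + (W⁻¹·(g − G′)/u^m)²`. [folklore] -/
theorem sq_eq_of_law_odd_unit [CharP K 2] {s' s u G' g W : K} {m : ℕ} (hu : u ≠ 0) (hW : W ≠ 0)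
    (hlaw : s' * u ^ m * W = s - G') :
    s' ^ 2 = u * (W⁻¹ ^ 2 * (s ^ 2 - g ^ 2) / u ^ (2 * m + 1)) + (W⁻¹ * (g - G') / u ^ m) ^ 2 := by
  have hlaw' : (s' * W) * u ^ m = s - G' := by rw [← hlaw]; ring
  have h := sq_eq_of_law_odd (g := g) hu hlaw'
  have hum : u ^ m ≠ 0 := pow_ne_zero _ hu
  have e : s' ^ 2 = W⁻¹ ^ 2 * (s' * W) ^ 2 := by field_simp
  rw [e, h]
  field_simp

/-! ## §3 The H3 core: residue zero at an A-stage ⇒ permissible centre at the next visit ⇒ positive step of height ≥ 2 -/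

section Core

variable [CharP K 2] {O : ValuationSubring K} {R : ℕ → Subring K} {P : (i : ℕ) → Ideal (R i)} {t : K} {s : ℕ → K}

/-- **H3 core.** In a steered run at `p = 2` whose members are dominated by `O` (`R 0` dominated), let `i < j′` be a VISIT PAIR with
`R i`, `R j′` regular, `dim R j′ = n ≥ 3`; at `i` let `(g, m₁, m₂, Ψ)` be a binary datum of ODD degree `d` which is the EXACT cleaned order
(`HasCleanedOrderAt R s 2 i d`), ON THE AXIS of an exceptional parameter `u` of the point step `i` (`v m₁, v m₂ < v u`), the members between the
visits constant (`R j′ = R (i+1)`) and the composite strict-transform law WITH UNIT COFACTOR `s j′ · u^(d/2) · W = s i − G′` (`G′ ∈ R j′`, `W` a unit of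
`R j′` — res-type-096's repaired clause 2 of `VisitLawAt`); if the torsor at `j′` has no singular prime of height `0` or `1` and `Ψ̄` HAS a zero over
the residue field of `R i`, then stage `j′` is a positive step of height `≥ 2`. [folklore] -/
theorem exists_posStepTwo_of_residue_zero (hrun : IsSteeredRun O R P t 2 s) (hR0 : SubringDominates (R 0) O.toSubring)
    {i j' : ℕ} (hvisit : IsVisitPair R P i j') [hregi : IsRegularLocalRing (R i)] [hregj : IsRegularLocalRing (R j')]
    {n : ℕ} (hn : 3 ≤ n) (hdim : ringKrullDim (R j') = n)
    {d : ℕ} (hd : Odd d) (hclean : HasCleanedOrderAt R s 2 i d)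
    (hs : s i ^ 2 ∈ R i) (g m₁ m₂ : R i) (Ψ : MvPolynomial (Fin 2) (R i))
    (hrsop : IsRsopPart ![m₁, m₂]) (hΨ : Ψ.IsHomogeneous d)
    (hcong : (⟨s i ^ 2, hs⟩ : R i) - g ^ 2 - MvPolynomial.eval ![m₁, m₂] Ψ ∈ maximalIdeal (R i) ^ (d + 1))
    {u : K} (hu : (∃ hu : u ∈ R i, (⟨u, hu⟩ : R i) ∈ P i) ∧ u ≠ 0 ∧ ∀ y : R i, y ∈ P i → O.valuation (y : K) ≤ O.valuation u)
    (hm₁ : O.valuation (m₁ : K) < O.valuation u) (hm₂ : O.valuation (m₂ : K) < O.valuation u)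
    (hRj : R j' = R (i + 1)) {G' W : K} (hG'R : G' ∈ R j') (hWi : W⁻¹ ∈ R j') (hW0 : W ≠ 0)
    (hlawEq : s j' * u ^ (d / 2) * W = s i - G')
    (h0 : ∀ (hs' : s j' ^ 2 ∈ R j') (Q : Ideal (R j')) [Q.IsPrime], Q.height = 0 →
      ¬ SigmaTopLegality.IsSingPrime (R j') 2 ⟨s j' ^ 2, hs'⟩ Q)
    (h1 : ∀ (hs' : s j' ^ 2 ∈ R j') (Q : Ideal (R j')) [Q.IsPrime], Q.height = 1 →
      ¬ SigmaTopLegality.IsSingPrime (R j') 2 ⟨s j' ^ 2, hs'⟩ Q)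
    (hzero : ∃ a b : ResidueField (R i), (a ≠ 0 ∨ b ≠ 0) ∧
      MvPolynomial.eval ![a, b] (MvPolynomial.map (residue (R i)) Ψ) = 0) :
    IsPosStep R P j' ∧ 2 ≤ (P j').height := by
  obtain ⟨hij, hpti, hptj, -⟩ := id hvisit
  -- the point step at `i` and its blow-up clause
  have hbl : ∀ k, IsLocalBlowupAlong O (R k) (P k) (R (k + 1)) := fun k => by
    obtain ⟨_, _, -, h, -⟩ := hrun.2 k
    exact h
  have hdom : ∀ k, SubringDominates (R k) O.toSubring :=
    SigmaTopLegality.subringDominates_of_isLocalBlowup O R hR0 fun k => (hbl k).isLocalBlowup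
  obtain ⟨hloci, hPi⟩ := hpti
  have hbl𝔪 : IsLocalBlowupAlong O (R i) (maximalIdeal (R i)) (R (i + 1)) := by
    have h := hbl i
    rw [hPi] at h
    exact h
  -- the next member is the blow-up of the A-stage member (strips keep the ring)
  have hbl' : IsLocalBlowupAlong O (R i) (maximalIdeal (R i)) (R j') := hRj ▸ hbl𝔪
  have hle : R i ≤ R j' := hbl'.isLocalBlowup.le
  -- the exceptional parameter `u`
  obtain ⟨⟨huR, huP⟩, hu0, humax⟩ := hu
  have hum : (⟨u, huR⟩ : R i) ∈ maximalIdeal (R i) := by rw [← hPi]; exact huP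
  have humax' : ∀ y : R i, y ∈ maximalIdeal (R i) → O.valuation (y : K) ≤ O.valuation u := fun y hy =>
    humax y (hPi ▸ hy)
  have hvu : O.valuation u < 1 :=
    SwitchRecurrence.valuation_lt_one_of_not_isUnit (hdom i) ⟨u, huR⟩ ((mem_maximalIdeal _).mp hum)
  -- `m₁, m₂ ∈ 𝔪`
  have hm₁𝔪 : m₁ ∈ maximalIdeal (R i) :=
    QuadraticStep.mem_maximalIdeal_of_valuation_lt_one (hdom i).1 m₁ (hm₁.trans hvu)
  have hm₂𝔪 : m₂ ∈ maximalIdeal (R i) :=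
    QuadraticStep.mem_maximalIdeal_of_valuation_lt_one (hdom i).1 m₂ (hm₂.trans hvu)
  -- `F := s² − g²`, `F − Ψ(m₁,m₂) ∈ 𝔪^(d+1)`, `F/u^d ∈ R j'`
  set F : R i := ⟨s i ^ 2, hs⟩ - g ^ 2 with hF
  have hFcong : F - MvPolynomial.eval ![m₁, m₂] Ψ ∈ maximalIdeal (R i) ^ (d + 1) := hcong
  obtain ⟨hGmem, -, -, -⟩ :=
    OddBranchParity.div_pow_mem_and_sub_eval_mem hbl' huR hum hu0 humax' Ψ hΨ hm₁𝔪 hm₂𝔪 hFcong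
  -- the radicand at `j'` and the law algebra
  obtain ⟨hlocj, hsj, -, -, -⟩ := hrun.2 j'
  obtain ⟨m, rfl⟩ : ∃ m, d = 2 * m + 1 := hd
  have hdiv : (2 * m + 1) / 2 = m := by omega
  rw [hdiv] at hlawEq
  have hum0 : u ^ m ≠ 0 := pow_ne_zero _ hu0
  have hsq : s j' ^ 2 =
      u * (W⁻¹ ^ 2 * ((F : R i) : K) / u ^ (2 * m + 1)) + (W⁻¹ * (((g : R i) : K) - G') / u ^ m) ^ 2 := by
    have h := sq_eq_of_law_odd_unit (g := ((g : R i) : K)) hu0 hW0 hlawEq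
    have hFK : ((F : R i) : K) = s i ^ 2 - ((g : R i) : K) ^ 2 := by simp [hF]
    rw [hFK, ← mul_div_assoc] at *
    exact h
  -- `h := W⁻¹ (g − G′)/u^m ∈ R j'`
  have hgR : W⁻¹ * (((g : R i) : K) - G') ∈ R j' := (R j').mul_mem hWi ((R j').sub_mem (hle g.2) hG'R)
  have humR : u ^ m ∈ R j' := (R j').pow_mem (hle huR) m
  have hG₁ : W⁻¹ ^ 2 * ((F : R i) : K) / u ^ (2 * m + 1) ∈ R j' := by
    have e : W⁻¹ ^ 2 * ((F : R i) : K) / u ^ (2 * m + 1) = W⁻¹ ^ 2 * (((F : R i) : K) / u ^ (2 * m + 1)) := by ring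
    rw [e]
    exact (R j').mul_mem ((R j').pow_mem hWi 2) hGmem
  have hhsq : (W⁻¹ * (((g : R i) : K) - G') / u ^ m) ^ 2 ∈ R j' := by
    have e : (W⁻¹ * (((g : R i) : K) - G') / u ^ m) ^ 2 =
        s j' ^ 2 - u * (W⁻¹ ^ 2 * ((F : R i) : K) / u ^ (2 * m + 1)) := by
      rw [hsq]; ring
    rw [e]
    exact (R j').sub_mem hsj ((R j').mul_mem (hle huR) hG₁)
  have hhR : W⁻¹ * (((g : R i) : K) - G') / u ^ m ∈ R j' := SwitchPlane.mem_of_sq_mem_transform hgR humR hum0 hhsq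
  -- the residue zero, lifted (pv-003)
  obtain ⟨a, b, hab, hzero'⟩ := OddBranchParity.exists_lift_of_residue_zero Ψ hzero
  -- pv-003's (R1) assembly at `j'` with `c := (W⁻¹)²`, `G := F/u^d`, `h := W⁻¹(g − G′)/u^m`
  have hf : (⟨s j' ^ 2, hsj⟩ : R j') =
      ⟨_, hhR⟩ ^ 2 + ⟨u, hle huR⟩ * (⟨W⁻¹, hWi⟩ ^ 2 * ⟨((F : R i) : K) / u ^ (2 * m + 1), hGmem⟩) := by
    apply Subtype.ext
    simp only [Subring.coe_mul, Subring.coe_add, SubmonoidClass.mk_pow]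
    rw [hsq]; ring
  obtain ⟨Q, hQ⟩ := OddBranchParity.exists_isPermissibleCentre_of_residue_zero (hdom i) hbl' huR hum hu0 humax'
    hrsop hm₁ hm₂ Ψ hΨ hab hzero' hFcong ⟨s j' ^ 2, hsj⟩ ⟨_, hhR⟩ (⟨W⁻¹, hWi⟩ ^ 2) ⟨_, hGmem⟩ rfl hf (h0 hsj) (h1 hsj)
    hn hdim
  -- σ_top maximality at `j'`
  exact SigmaTopMaximality.isPosStep_and_two_le_height_of_exists_isPermissibleCentre' hrun j'
    (fun _ _ => ⟨Q, hQ⟩) h0 h1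

end Core

/-! ## §4 The slot (H3) from the pieces -/

section Slot

variable [CharP K 2] {O : ValuationSubring K} {R : ℕ → Subring K} {P : (i : ℕ) → Ideal (R i)} {t : K} {s : ℕ → K}

/-- **(H3) FROM THE PIECES.** In a steered run at `p = 2` (`R 0` dominated by `O`) whose point steps recur, suppose: (S1a) at every late visit pair the member stays constant and the unit-cofactor strict-transform law holds (res-type-096's repaired
`VisitLawAt` clause 2, «MINIMAL REPAIR» 13:43:45Z — here a hypothesis in that exact shape), every member is regular of dimension `n ≥ 3`, and beyond stage `N` the torsor
at a point step has no singular prime of height `0` or `1` (the run's N4 regime). Then the legality slot (H3) of the ARITH-REDUCTION holds beyond `N`: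
at a late A-STAGE `i` of odd cleaned order `d`, an on-axis binary datum whose reduction has a zero forces a LATER positive step of height `≥ 2`.
[folklore] -/
theorem H3_of_pieces (hrun : IsSteeredRun O R P t 2 s) (hR0 : SubringDominates (R 0) O.toSubring)
    (hrec : ∀ i₀, ∃ i, i₀ ≤ i ∧ IsPointStep R P i) {N : ℕ}
    (hS1a : ∀ (j j' : ℕ) (x : K) (ν : ℕ), N ≤ j → IsVisitPair R P j j' →
      ((∃ hx : x ∈ R j, (⟨x, hx⟩ : R j) ∈ P j) ∧ x ≠ 0 ∧ ∀ y : R j, y ∈ P j → O.valuation (y : K) ≤ O.valuation x) →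
      HasCleanedOrderAt R s 2 j ν →
      R j' = R (j + 1) ∧ ∃ G W : K, G ∈ R j' ∧ W ∈ R j' ∧ W⁻¹ ∈ R j' ∧ W ≠ 0 ∧ s j' * x ^ (ν / 2) * W = s j - G)
    (hreg : ∀ i, IsRegularLocalRing (R i)) {n : ℕ} (hn : 3 ≤ n) (hdim : ∀ i, ringKrullDim (R i) = n)
    (h0 : ∀ j, N ≤ j → IsPointStep R P j → ∀ (hs' : s j ^ 2 ∈ R j) (Q : Ideal (R j)) [Q.IsPrime], Q.height = 0 →
      ¬ SigmaTopLegality.IsSingPrime (R j) 2 ⟨s j ^ 2, hs'⟩ Q)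
    (h1 : ∀ j, N ≤ j → IsPointStep R P j → ∀ (hs' : s j ^ 2 ∈ R j) (Q : Ideal (R j)) [Q.IsPrime], Q.height = 1 →
      ¬ SigmaTopLegality.IsSingPrime (R j) 2 ⟨s j ^ 2, hs'⟩ Q)
    {d : ℕ} (hd : Odd d) :
    ∀ (i : ℕ), N ≤ i → IsAStageAt R P s 2 i d →
      ∀ (_ : IsLocalRing (R i)) (hs : s i ^ 2 ∈ R i) (g m₁ m₂ : R i) (Ψ : MvPolynomial (Fin 2) (R i)) (u : K),
        IsRsopPart ![m₁, m₂] → Ψ.IsHomogeneous d →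
        (⟨s i ^ 2, hs⟩ : R i) - g ^ 2 - MvPolynomial.eval ![m₁, m₂] Ψ ∈ maximalIdeal (R i) ^ (d + 1) →
        ((∃ hu : u ∈ R i, (⟨u, hu⟩ : R i) ∈ P i) ∧ u ≠ 0 ∧ ∀ y : R i, y ∈ P i → O.valuation (y : K) ≤ O.valuation u) →
        O.valuation (m₁ : K) < O.valuation u → O.valuation (m₂ : K) < O.valuation u →
        (∃ a b : ResidueField (R i), (a ≠ 0 ∨ b ≠ 0) ∧
          MvPolynomial.eval ![a, b] (MvPolynomial.map (residue (R i)) Ψ) = 0) →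
        ∃ j', i < j' ∧ IsPosStep R P j' ∧ 2 ≤ (P j').height := by
  intro i hNi hA hloc hs g m₁ m₂ Ψ u hrsop hΨ hcong hu hm₁ hm₂ hzero
  obtain ⟨hpt, -, -, hclean⟩ := hA
  obtain ⟨j', hvisit⟩ := exists_isVisitPair hrec hpt
  have hij : i < j' := hvisit.1
  haveI := hreg i
  haveI := hreg j'
  obtain ⟨hRj, G', W, hG'R, -, hWi, hW0, hlawEq⟩ := hS1a i j' u d hNi hvisit hu hclean
  have h := exists_posStepTwo_of_residue_zero hrun hR0 hvisit hn (hdim j') hd hclean hs g m₁ m₂ Ψ hrsop hΨ hcong hu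
    hm₁ hm₂ hRj hG'R hWi hW0 hlawEq (h0 j' (hNi.trans hij.le) hvisit.2.2.1) (h1 j' (hNi.trans hij.le) hvisit.2.2.1) hzero
  exact ⟨j', hij, h⟩

end Slot

/-! ## §5 STAGE 1 glue, v3: (H2) outputs an A-STAGE, (H3) consumes it -/

section GlueV3

variable {O : ValuationSubring K} {R : ℕ → Subring K} {P : (i : ℕ) → Ideal (R i)} {s : ℕ → K}

/-- **hARᵒ ASSEMBLED, A-STAGE form.** As `ArithReduction.arithSwitchClause_of_bricks_onAxis` but the stage produced by (H2) is an A-STAGE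
(`Words.IsAStageAt R P s p i d`: point step, no odd divisor, `d` odd and the EXACT cleaned order), which (H3) consumes — the cleaned order must
be exactly `d` for legality to bite (at a B-stage `Ψ = 0` satisfies the congruence). [folklore] -/
theorem arithSwitchClause_of_AStage_bricks (p : ℕ) (hbl : ∀ i, IsLocalBlowupAlong O (R i) (P i) (R (i + 1)))
    (h0 : SubringDominates (R 0) O.toSubring) (hrec : ∀ i₀, ∃ i, i₀ ≤ i ∧ IsPointStep R P i)
    (hnp : ¬ ∃ i₀ : ℕ, ∃ x : K, x ≠ 0 ∧ x ∈ O ∧ O.valuation x < 1 ∧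
      ∀ i, i₀ ≤ i → ∀ y ∈ R i, O.valuation y < 1 → ∃ j, i < j ∧ y / x ∈ R j)
    {d : ℕ} (hd : Odd d) (h3 : 3 ≤ d) {N : ℕ}
    (hlate : ∀ j, N ≤ j → IsPosStep R P j → (P j).height < 2)
    (H2 : ∀ (j j' : ℕ) (x : K), N ≤ j → j < j' → IsPointStep R P j → IsPointStep R P j' →
      ((∃ hx : x ∈ R j, (⟨x, hx⟩ : R j) ∈ P j) ∧ x ≠ 0 ∧ ∀ y : R j, y ∈ P j → O.valuation (y : K) ≤ O.valuation x) →
      ¬ ((∃ hx : x ∈ R j', (⟨x, hx⟩ : R j') ∈ P j') ∧ ∀ y : R j', y ∈ P j' → O.valuation (y : K) ≤ O.valuation x) →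
      ∃ i, j ≤ i ∧ i ≤ j' ∧ IsAStageAt R P s p i d ∧
        ∃ (_ : IsLocalRing (R i)) (hs : s i ^ p ∈ R i) (g m₁ m₂ : R i) (Ψ : MvPolynomial (Fin 2) (R i)) (u : K),
          IsRsopPart ![m₁, m₂] ∧ Ψ.IsHomogeneous d ∧
          (⟨s i ^ p, hs⟩ : R i) - g ^ 2 - MvPolynomial.eval ![m₁, m₂] Ψ ∈ maximalIdeal (R i) ^ (d + 1) ∧
          ((∃ hu : u ∈ R i, (⟨u, hu⟩ : R i) ∈ P i) ∧ u ≠ 0 ∧ ∀ y : R i, y ∈ P i → O.valuation (y : K) ≤ O.valuation u) ∧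
          O.valuation (m₁ : K) < O.valuation u ∧ O.valuation (m₂ : K) < O.valuation u)
    (H3 : ∀ (i : ℕ), N ≤ i → IsAStageAt R P s p i d →
      ∀ (_ : IsLocalRing (R i)) (hs : s i ^ p ∈ R i) (g m₁ m₂ : R i) (Ψ : MvPolynomial (Fin 2) (R i)) (u : K),
        IsRsopPart ![m₁, m₂] → Ψ.IsHomogeneous d →
        (⟨s i ^ p, hs⟩ : R i) - g ^ 2 - MvPolynomial.eval ![m₁, m₂] Ψ ∈ maximalIdeal (R i) ^ (d + 1) →
        ((∃ hu : u ∈ R i, (⟨u, hu⟩ : R i) ∈ P i) ∧ u ≠ 0 ∧ ∀ y : R i, y ∈ P i → O.valuation (y : K) ≤ O.valuation u) →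
        O.valuation (m₁ : K) < O.valuation u → O.valuation (m₂ : K) < O.valuation u →
        (∃ a b : ResidueField (R i), (a ≠ 0 ∨ b ≠ 0) ∧
          MvPolynomial.eval ![a, b] (MvPolynomial.map (residue (R i)) Ψ) = 0) →
        ∃ j', i < j' ∧ IsPosStep R P j' ∧ 2 ≤ (P j').height) :
    ArithSwitchClause R P s p := by
  refine ⟨d, hd, h3, fun i₀ => ?_⟩
  obtain ⟨j, j', x, hj, hjj', hpt, hpt', hx, hnot⟩ :=
    SwitchRecurrence.exists_switch_pair_beyond_of_not_persistent hbl h0 hrec hnp (max i₀ N)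
  have hjN : N ≤ j := (le_max_right _ _).trans hj
  have hji₀ : i₀ ≤ j := (le_max_left _ _).trans hj
  obtain ⟨i, hji, -, hA, hloc, hs, g, m₁, m₂, Ψ, u, hrsop, hhom, hcong, hu, hm₁, hm₂⟩ :=
    H2 j j' x hjN hjj' hpt hpt' hx hnot
  refine ⟨i, hji₀.trans hji, hA.1, hloc, hs, g, m₁, m₂, Ψ, hrsop, hhom, hcong, ?_⟩
  intro a b hab hzero
  obtain ⟨j'', hij'', hpos, hht⟩ :=
    H3 i (hjN.trans hji) hA hloc hs g m₁ m₂ Ψ u hrsop hhom hcong hu hm₁ hm₂ ⟨a, b, hab, hzero⟩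
  have hlt := hlate j'' ((hjN.trans hji).trans hij''.le) hpos
  exact absurd hht (not_le.mpr hlt)

/-- **hARᵒ from the run with (H3) DISCHARGED by the pieces** (`p = 2`): the only remaining NAMED GEOMETRIC SLOT is (H2) «a late switch pair has an
on-axis binary A-stage between its ends» ((R2)/(R4) over res-type-096's cone cores + the member datum); (S1b) `EventuallyConstantReducedOrder`,
(S1a) the visit law, member regularity / dimension `4` and the N4 heights are tree theorems or res-type-096's targets, here hypotheses by name.
[folklore] -/
theorem arithSwitchClause_of_H2 [CharP K 2] {k : Type} [Field k] [Algebra k K] (A₀ : Subalgebra k K)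
    (h₀ : A₀.toSubring ≤ O.toSubring) {t : K} (hR0 : R 0 = locAtCentre A₀.toSubring O)
    (hrun : IsSteeredRun O R P t 2 s)
    (hnp : ¬ ∃ i₀ : ℕ, ∃ x : K, x ≠ 0 ∧ x ∈ O ∧ O.valuation x < 1 ∧
      ∀ i, i₀ ≤ i → ∀ y ∈ R i, O.valuation y < 1 → ∃ j, i < j ∧ y / x ∈ R j)
    (hfin2 : ¬ {j | IsPosStep R P j ∧ 2 ≤ (P j).height}.Infinite)
    (hS1b : EventuallyConstantReducedOrder R P s 2) {N₁ : ℕ}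
    (hS1a : ∀ (j j' : ℕ) (x : K) (ν : ℕ), N₁ ≤ j → IsVisitPair R P j j' →
      ((∃ hx : x ∈ R j, (⟨x, hx⟩ : R j) ∈ P j) ∧ x ≠ 0 ∧ ∀ y : R j, y ∈ P j → O.valuation (y : K) ≤ O.valuation x) →
      HasCleanedOrderAt R s 2 j ν →
      R j' = R (j + 1) ∧ ∃ G W : K, G ∈ R j' ∧ W ∈ R j' ∧ W⁻¹ ∈ R j' ∧ W ≠ 0 ∧ s j' * x ^ (ν / 2) * W = s j - G)
    (hreg : ∀ i, IsRegularLocalRing (R i)) (hdim : ∀ i, ringKrullDim (R i) = (4 : ℕ))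
    (h0 : ∀ j, N₁ ≤ j → IsPointStep R P j → ∀ (hs' : s j ^ 2 ∈ R j) (Q : Ideal (R j)) [Q.IsPrime], Q.height = 0 →
      ¬ SigmaTopLegality.IsSingPrime (R j) 2 ⟨s j ^ 2, hs'⟩ Q)
    (h1 : ∀ j, N₁ ≤ j → IsPointStep R P j → ∀ (hs' : s j ^ 2 ∈ R j) (Q : Ideal (R j)) [Q.IsPrime], Q.height = 1 →
      ¬ SigmaTopLegality.IsSingPrime (R j) 2 ⟨s j ^ 2, hs'⟩ Q)
    (H2 : ∀ (d i₁ N : ℕ), Odd d → 3 ≤ d → (∀ i, i₁ ≤ i → IsPointStep R P i → HasReducedOrderAt R s 2 i d) →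
      (∀ i₀, ∃ i, i₀ ≤ i ∧ IsAStageAt R P s 2 i d) →
      ∀ (j j' : ℕ) (x : K), max N i₁ ≤ j → j < j' → IsPointStep R P j → IsPointStep R P j' →
      ((∃ hx : x ∈ R j, (⟨x, hx⟩ : R j) ∈ P j) ∧ x ≠ 0 ∧ ∀ y : R j, y ∈ P j → O.valuation (y : K) ≤ O.valuation x) →
      ¬ ((∃ hx : x ∈ R j', (⟨x, hx⟩ : R j') ∈ P j') ∧ ∀ y : R j', y ∈ P j' → O.valuation (y : K) ≤ O.valuation x) →
      ∃ i, j ≤ i ∧ i ≤ j' ∧ IsAStageAt R P s 2 i d ∧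
        ∃ (_ : IsLocalRing (R i)) (hs : s i ^ 2 ∈ R i) (g m₁ m₂ : R i) (Ψ : MvPolynomial (Fin 2) (R i)) (u : K),
          IsRsopPart ![m₁, m₂] ∧ Ψ.IsHomogeneous d ∧
          (⟨s i ^ 2, hs⟩ : R i) - g ^ 2 - MvPolynomial.eval ![m₁, m₂] Ψ ∈ maximalIdeal (R i) ^ (d + 1) ∧
          ((∃ hu : u ∈ R i, (⟨u, hu⟩ : R i) ∈ P i) ∧ u ≠ 0 ∧ ∀ y : R i, y ∈ P i → O.valuation (y : K) ≤ O.valuation u) ∧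
          O.valuation (m₁ : K) < O.valuation u ∧ O.valuation (m₂ : K) < O.valuation u) :
    ArithSwitchClause R P s 2 := by
  have hbl : ∀ i, IsLocalBlowupAlong O (R i) (P i) (R (i + 1)) := fun i => by
    obtain ⟨_, _, -, h, -⟩ := hrun.2 i
    exact h
  have hdom0 : SubringDominates (R 0) O.toSubring := by
    rw [hR0]
    exact subringDominates_locAtCentre h₀
  obtain ⟨N₂, hlate⟩ := ArithReduction.exists_bound_of_not_infinite_posStepTwo hfin2
  obtain ⟨d, i₁, hd, h3, hred, hA⟩ := hS1b
  have hrec : ∀ i₀, ∃ i, i₀ ≤ i ∧ IsPointStep R P i := fun i₀ => by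
    obtain ⟨i, hi, hAi⟩ := hA i₀
    exact ⟨i, hi, hAi.1⟩
  -- common lateness bound
  set N := max (max N₁ N₂) i₁ with hN
  have hN₁ : N₁ ≤ max N₁ N₂ := le_max_left _ _
  have hN₂ : N₂ ≤ max N₁ N₂ := le_max_right _ _
  refine arithSwitchClause_of_AStage_bricks 2 hbl hdom0 hrec hnp hd h3 (N := N)
    (fun j hj hpos => hlate j (hN₂.trans ((le_max_left _ _).trans hj)) hpos)
    (H2 d i₁ (max N₁ N₂) hd h3 hred hA) ?_
  intro i hi hAi hloc hs g m₁ m₂ Ψ u hrsop hhom hcong hu hm₁ hm₂ hzero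
  exact H3_of_pieces hrun hdom0 hrec hS1a hreg (n := 4) (by norm_num) hdim
    (fun j hj hptj => h0 j hj hptj) (fun j hj hptj => h1 j hj hptj) hd i (hN₁.trans ((le_max_left _ _).trans hi))
    hAi hloc hs g m₁ m₂ Ψ u hrsop hhom hcong hu hm₁ hm₂ hzero

end GlueV3

end ArithReductionLegality

end Summit.ResolutionOfSingularities.ResolutionOfSingularities.Theorems.SwitchingDichotomy
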